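import Summits.QuantumFields.YangMills.Theorems.FluctuationComparisonRegPrIntLS2BetaCritMQuaternionRead
import Summits.QuantumFields.YangMills.Theorems.FluctuationComparisonRegPrIntLS2BetaChartReadDescentDerivFactorisation
import Summits.QuantumFields.YangMills.Theorems.FluctuationComparisonRegPrIntLS2BetaChartReadGaugeAndLocality
import HarnessLib

/-!
# S2β · THE DICTIONARY `DMq ↔ DΨ_{K−J}`: the quaternion-read derivative of the (0.4) descent (✓p825180, the (PRE) currency) read through ✓p823800's chart-read iterate
# `Ψ_k` (px13 g25 ∕ px16 g21's currency), and the first transported consequence (block locality)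

Cell `ym3-torus` (YM ladder rung R3 = continuum `SU(2)` Yang–Mills on the three-torus at fixed lattice data — a RUNG: NOT d = 4, NOT infinite volume, NOT a mass gap,
NOT Clay).  Width seat `ym3-torus-px5` (gen 22); crux `stmt-QuantumFields-20520` (`…Theses.UnitScaleTilt.FluctuationComparisonRegPrIntL`), LINE g18-1 S2β, organ GAP♯∘
⟸ «CRIT-ax» ⟸ «MULT♭-ax» (✓p824141) ⟸ (PRE) = {CRIT-m♮ set form ✓p825180∕✓p825391, (RINV-curl) [px16 g21: face spreads, door ✓`…PreimagesOfFaceSpreads`], AVG₂♭-ax [px10 g23]}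
∧ BKG ✓p822405; `--kind proof --supports stmt-QuantumFields-20520 --as helper`, count-neutral, DEFINITION-FREE (0 `def`, 0 `instance`, 0 `notation`, 0 `sorry`, default
heartbeats).  Q3 of the quaternion-read series (Q1 ✓p825180, Q2 ✓p825391).

WHY.  (PRE) quantifies `DM : (PBond (F.P K) 0 → ℝ³) → (PBond (F.P J) 0 → ℝ³)`; Q1 pins it as `DMq(U₀) := fderiv (ζ B ↦ imVec (su2Quat (D(expPoint ζ•U₀) B·D(U₀) B⁻¹))) 0`.
The (RINV-curl) road (px16's face spreads (B1)(B2)(B3′), px13's (D0)(D1)(D2)(E)) computes with ✓p823800's `DΨ_k(0)` on `𝔰𝔲(2)`-valued fields over the `(F.P K)`-level-`k`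
bonds.  THIS FILE is the one-line dictionary between the two, so that every identity ∕ vanishing ∕ bound proved for `DΨ_{K−J}(0)` reads in (PRE)'s currency by `rw`.

WHAT IS PROVED (sorry-free; guards = FILE C's: `U₀ ∈ histGood F ℰp θ K J`, `0 ≤ θ`, `(5L)²∕4·θ_i ≤ α` on `J < i ≤ K`, `α ≤ 1∕24`, `α < δ_{SU(2)}`, `157α < L⁻²`).
§1 ★★`coord_qfderiv_apply` — **`⟨su2Coord (rev ((DMq ζ) B)), _⟩ = (DΨ_{K−J}(0) (b ↦ ⟨su2Coord (rev (ζ b)), _⟩)) (bondShift _ B)`** for every `ζ` and coarse `B : PBond (F.P J) 0`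
   (Q1 `DMq = ↑E.symm ∘L DM` + px13 (E) ✓`fderiv_chartRead_descendTo_expPoint_apply`); ★`coe_coord_qfderiv_apply` — the same in the matrix algebra:
   `su2Coord (rev ((DMq ζ) B)) = ↑((DΨ_{K−J}(0) …) (bondShift _ B))` (the TRANSFER RULE: a matrix identity for the right side IS an identity for `su2Coord (rev ((DMq ζ) B))`);
   ★`qfderiv_apply_eq_iff` — `(DMq ζ) B = v ↔ (DΨ_{K−J}(0) …) (bondShift _ B) = ⟨su2Coord (rev v), _⟩`.
§2 ★★`qfderiv_apply_eq_zero_of_forall` — px16's (B1′) ✓`fderiv_chartRead_iter_apply_eq_zero_of_forall` TRANSPORTED: if `X : PBond (F.P K) 0 → ℝ³` vanishes on every fine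
   bond both of whose endpoints' `(K−J)`-blocks lie in `{(bondShift B)₋, (bondShift B)₊}`, then `(DMq X) B = 0`.

HONEST SCOPE.  Dictionary bookkeeping; nothing of Bałaban's analysis is asserted or proved here; (RINV-curl), (D2), AVG₂♭-ax, MULT♮, «CRIT-ax», (D-ax)∕(F-ax), GAP♯∘
(`stub_uniformFibreGapOrbit`, registry 3732b7df UNTOUCHED), S2β, the five registered stubs, 20520, `YM3TorusSU2` are NOT proved; rung R3 — NOT d = 4, NOT infinite volume, NOT
a mass gap, NOT Clay.
-/

set_option autoImplicit false

noncomputable section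

open scoped Matrix.Norms.L2Operator Topology
open Filter Set Function
open Literature.MathematicalPhysics.QuantumLattice (su2Quat)
open Literature.MathematicalPhysics.QuantumFieldTheory.Balaban1983to89
open Literature.MathematicalPhysics.QuantumFieldTheory.Balaban1983to89.HaarExponentialChart
open Literature.MathematicalPhysics.QuantumFieldTheory.Balaban1983to89.HaarExponentialChart.IsChartRep
open Literature.MathematicalPhysics.QuantumFieldTheory.Balaban1983to89.BlockAveraging (blockAvg)
open Literature.MathematicalPhysics.QuantumFieldTheory.Balaban1983to89.ExpMeanLog (expMeanLogSU deltaSU)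
open Literature.MathematicalPhysics.QuantumFieldTheory.Balaban1983to89.Node00
open Literature.MathematicalPhysics.QuantumFieldTheory.Balaban1983to89.T3ContinuumYM3Torus
open Literature.MathematicalPhysics.QuantumFieldTheory.Balaban1983to89.T3UnitLawDensityEML (ℰp)
open Literature.MathematicalPhysics.QuantumFieldTheory.Balaban1983to89.T3UnitScaleTilt
open Literature.MathematicalPhysics.QuantumFieldTheory.Balaban1983to89.T3TiltDescent
open Literature.MathematicalPhysics.QuantumFieldTheory.Balaban1983to89.T3LevelShift (fieldShift bondShift)
open Literature.MathematicalPhysics.QuantumFieldTheory.Balaban1983to89.T4HaarSU2ExpChart (expPoint)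
open Literature.MathematicalPhysics.QuantumFieldTheory.Balaban1983to89.T4ExpWindowSmallField (imVec)
open Literature.MathematicalPhysics.QuantumFieldTheory.Balaban1983to89.B10Eq18SigmaSU2 (su2Coord su2Coord_injective)
open Literature.MathematicalPhysics.QuantumFieldTheory.Balaban1983to89.B13HaarSigmaJacobian (su2Coordₗ su2Coordₗ_apply_coe)
open Literature.MathematicalPhysics.QuantumFieldTheory.Balaban1983to89.B10Eq18SigmaSU2Haar (rev)
open Literature.MathematicalPhysics.QuantumFieldTheory.Balaban1983to89.T4Continuum
open Summit.QuantumFields.YangMills.Theorems.FluctuationComparisonRegPrIntLS2BetaChartReadDescentOntoExpPoint (su2Coord_rev_mem_lie exists_coordEquiv)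
open Summit.QuantumFields.YangMills.Theorems.FluctuationComparisonRegPrIntLS2BetaChartReadDescentDerivFactorisation (fderiv_chartRead_descendTo_expPoint_apply)
open Summit.QuantumFields.YangMills.Theorems.FluctuationComparisonRegPrIntLS2BetaChartReadGaugeAndLocality (fderiv_chartRead_iter_apply_eq_zero_of_forall)
open Summit.QuantumFields.YangMills.Theorems.FluctuationComparisonRegPrIntLS2BetaCritMQuaternionRead (hasStrictFDerivAt_qRead_descendTo)

namespace Summit.QuantumFields.YangMills.Theorems.FluctuationComparisonRegPrIntLS2BetaQuaternionReadDictionary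

variable {F : T3Family}

/-! ## §1 The dictionary -/

section Dictionary

/-- ★★ **THE DICTIONARY**: in Pauli coordinates, the quaternion-read derivative `DMq(U₀)` (✓p825180) at a coarse bond `B` IS ✓p823800's chart-read derivative `DΨ_{K−J}(0)`
on the coordinates of `ζ`, read at the identified bond `bondShift _ B` (Q1's `DMq = ↑E.symm ∘L DM` composed with px13's (E)).
[cite: Balaban1987RG1, (0.4), (0.11) p.253; Balaban1985UV3, p. 260 (bookkeeping)] -/
theorem coord_qfderiv_apply {J K : ℕ} (hJK : J ≤ K) {θ : ℕ → ℝ} (hθ0 : ∀ i, 0 ≤ θ i) {α : ℝ}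
    (hθα : ∀ i, J < i → i ≤ K → (((5 * F.L : ℕ) : ℝ) ^ 2 / 4) * θ i ≤ α)
    (hα24 : α ≤ 1 / 24) (hαδ : α < deltaSU (Fin 2)) (hαL : 157 * α < ((F.L : ℝ) ^ 2)⁻¹)
    {U₀ : GaugeField (F.P K) 0 (SU 2)} (hUg : U₀ ∈ histGood F ℰp θ K J)
    (ζ : PBond (F.P K) 0 → EuclideanSpace ℝ (Fin 3)) (B : PBond (F.P J) 0) :
    (⟨su2Coord (rev (fderiv ℝ (fun (ζ : PBond (F.P K) 0 → EuclideanSpace ℝ (Fin 3)) (B : PBond (F.P J) 0) =>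
        imVec (su2Quat (descendTo F ℰp J K hJK (fun ℓ => expPoint (ζ ℓ) * U₀ ℓ) B * (descendTo F ℰp J K hJK U₀ B)⁻¹))) 0 ζ B)),
      su2Coord_rev_mem_lie _⟩ : (specialUnitaryLogChart (Fin 2)).lie) =
      fderiv ℝ (fun (A : PBond (F.P K) 0 → (specialUnitaryLogChart (Fin 2)).lie) (c : PBond (F.P K) (K - J)) =>
          (isChartRep_specialUnitaryGroup (n := Fin 2)).logChart
            (Averaging.iter (fun i => blockAvg (P := F.P K) (j := i) (expMeanLogSU (n := Fin 2))) (K - J)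
                (fun b => (isChartRep_specialUnitaryGroup (n := Fin 2)).expChart (A b) * U₀ b) c *
              (Averaging.iter (fun i => blockAvg (P := F.P K) (j := i) (expMeanLogSU (n := Fin 2))) (K - J) U₀ c)⁻¹)) 0
        (fun b => (⟨su2Coord (rev (ζ b)), su2Coord_rev_mem_lie (ζ b)⟩ : (specialUnitaryLogChart (Fin 2)).lie))
        (bondShift (F.sitesPerDir_eq (m := F.m) (K := J) (j := 0) (m' := F.m) (K' := K) (j' := K - J) (by omega)) B) := by
  have hθδ : ∀ i, J < i → i ≤ K → (((5 * F.L : ℕ) : ℝ) ^ 2 / 4) * θ i < deltaSU (Fin 2) :=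
    fun i hi hiK => (hθα i hi hiK).trans_lt hαδ
  obtain ⟨-, -, hqE⟩ := hasStrictFDerivAt_qRead_descendTo (F := F) hJK hθ0 hθα hα24 hαδ hαL hUg
  obtain ⟨E, hE⟩ := exists_coordEquiv (F.P J) 0
  have hD := hqE E hE
  have h1 : E (fderiv ℝ (fun (ζ : PBond (F.P K) 0 → EuclideanSpace ℝ (Fin 3)) (B : PBond (F.P J) 0) =>
        imVec (su2Quat (descendTo F ℰp J K hJK (fun ℓ => expPoint (ζ ℓ) * U₀ ℓ) B * (descendTo F ℰp J K hJK U₀ B)⁻¹))) 0 ζ) =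
      fderiv ℝ (fun (ζ : PBond (F.P K) 0 → EuclideanSpace ℝ (Fin 3)) (B : PBond (F.P J) 0) =>
        (isChartRep_specialUnitaryGroup (n := Fin 2)).logChart
          (descendTo F ℰp J K hJK (fun ℓ => expPoint (ζ ℓ) * U₀ ℓ) B * (descendTo F ℰp J K hJK U₀ B)⁻¹)) 0 ζ := by
    rw [hD, ContinuousLinearMap.comp_apply, ContinuousLinearEquiv.coe_coe, ContinuousLinearEquiv.apply_symm_apply]
  have h2 := congrFun h1 B
  rw [hE] at h2
  rw [h2]
  exact fderiv_chartRead_descendTo_expPoint_apply (F := F) hJK hθ0 hθδ hUg ζ B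

/-- ★ **THE TRANSFER RULE** (coercion of `coord_qfderiv_apply` to the matrix algebra): `su2Coord (rev ((DMq ζ) B)) = ↑((DΨ_{K−J}(0) …) (bondShift _ B))` — so a matrix identity
for the right side (px16's (B2)∕(B3′) `coe_…` theorems) is an identity for the Pauli coordinates of `(DMq ζ) B`. [cite: Balaban1987RG1, (0.11) p.253 (bookkeeping)] -/
theorem coe_coord_qfderiv_apply {J K : ℕ} (hJK : J ≤ K) {θ : ℕ → ℝ} (hθ0 : ∀ i, 0 ≤ θ i) {α : ℝ}
    (hθα : ∀ i, J < i → i ≤ K → (((5 * F.L : ℕ) : ℝ) ^ 2 / 4) * θ i ≤ α)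
    (hα24 : α ≤ 1 / 24) (hαδ : α < deltaSU (Fin 2)) (hαL : 157 * α < ((F.L : ℝ) ^ 2)⁻¹)
    {U₀ : GaugeField (F.P K) 0 (SU 2)} (hUg : U₀ ∈ histGood F ℰp θ K J)
    (ζ : PBond (F.P K) 0 → EuclideanSpace ℝ (Fin 3)) (B : PBond (F.P J) 0) :
    su2Coord (rev (fderiv ℝ (fun (ζ : PBond (F.P K) 0 → EuclideanSpace ℝ (Fin 3)) (B : PBond (F.P J) 0) =>
        imVec (su2Quat (descendTo F ℰp J K hJK (fun ℓ => expPoint (ζ ℓ) * U₀ ℓ) B * (descendTo F ℰp J K hJK U₀ B)⁻¹))) 0 ζ B)) =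
      Subtype.val (fderiv ℝ (fun (A : PBond (F.P K) 0 → (specialUnitaryLogChart (Fin 2)).lie) (c : PBond (F.P K) (K - J)) =>
          (isChartRep_specialUnitaryGroup (n := Fin 2)).logChart
            (Averaging.iter (fun i => blockAvg (P := F.P K) (j := i) (expMeanLogSU (n := Fin 2))) (K - J)
                (fun b => (isChartRep_specialUnitaryGroup (n := Fin 2)).expChart (A b) * U₀ b) c *
              (Averaging.iter (fun i => blockAvg (P := F.P K) (j := i) (expMeanLogSU (n := Fin 2))) (K - J) U₀ c)⁻¹)) 0
        (fun b => (⟨su2Coord (rev (ζ b)), su2Coord_rev_mem_lie (ζ b)⟩ : (specialUnitaryLogChart (Fin 2)).lie))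
        (bondShift (F.sitesPerDir_eq (m := F.m) (K := J) (j := 0) (m' := F.m) (K' := K) (j' := K - J) (by omega)) B)) :=
  congrArg Subtype.val (coord_qfderiv_apply hJK hθ0 hθα hα24 hαδ hαL hUg ζ B)

/-- ★ **READING A VALUE OF `DMq` OFF `DΨ_{K−J}(0)`**: `(DMq ζ) B = v ↔ (DΨ_{K−J}(0) …) (bondShift _ B) = ⟨su2Coord (rev v), _⟩` (Pauli coordinates are injective).
[cite: Balaban1987RG1, (0.11) p.253 (bookkeeping)] -/
theorem qfderiv_apply_eq_iff {J K : ℕ} (hJK : J ≤ K) {θ : ℕ → ℝ} (hθ0 : ∀ i, 0 ≤ θ i) {α : ℝ}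
    (hθα : ∀ i, J < i → i ≤ K → (((5 * F.L : ℕ) : ℝ) ^ 2 / 4) * θ i ≤ α)
    (hα24 : α ≤ 1 / 24) (hαδ : α < deltaSU (Fin 2)) (hαL : 157 * α < ((F.L : ℝ) ^ 2)⁻¹)
    {U₀ : GaugeField (F.P K) 0 (SU 2)} (hUg : U₀ ∈ histGood F ℰp θ K J)
    (ζ : PBond (F.P K) 0 → EuclideanSpace ℝ (Fin 3)) (B : PBond (F.P J) 0) (v : EuclideanSpace ℝ (Fin 3)) :
    fderiv ℝ (fun (ζ : PBond (F.P K) 0 → EuclideanSpace ℝ (Fin 3)) (B : PBond (F.P J) 0) =>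
        imVec (su2Quat (descendTo F ℰp J K hJK (fun ℓ => expPoint (ζ ℓ) * U₀ ℓ) B * (descendTo F ℰp J K hJK U₀ B)⁻¹))) 0 ζ B = v ↔
      fderiv ℝ (fun (A : PBond (F.P K) 0 → (specialUnitaryLogChart (Fin 2)).lie) (c : PBond (F.P K) (K - J)) =>
          (isChartRep_specialUnitaryGroup (n := Fin 2)).logChart
            (Averaging.iter (fun i => blockAvg (P := F.P K) (j := i) (expMeanLogSU (n := Fin 2))) (K - J)
                (fun b => (isChartRep_specialUnitaryGroup (n := Fin 2)).expChart (A b) * U₀ b) c *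
              (Averaging.iter (fun i => blockAvg (P := F.P K) (j := i) (expMeanLogSU (n := Fin 2))) (K - J) U₀ c)⁻¹)) 0
        (fun b => (⟨su2Coord (rev (ζ b)), su2Coord_rev_mem_lie (ζ b)⟩ : (specialUnitaryLogChart (Fin 2)).lie))
        (bondShift (F.sitesPerDir_eq (m := F.m) (K := J) (j := 0) (m' := F.m) (K' := K) (j' := K - J) (by omega)) B) =
      (⟨su2Coord (rev v), su2Coord_rev_mem_lie v⟩ : (specialUnitaryLogChart (Fin 2)).lie) := by
  rw [← coord_qfderiv_apply hJK hθ0 hθα hα24 hαδ hαL hUg ζ B]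
  constructor
  · intro h; rw [h]
  · intro h
    have h' := congrArg Subtype.val h
    exact rev.injective (WithLp.ofLp_injective 2 (su2Coord_injective h'))

end Dictionary

/-! ## §2 The first transported consequence: block locality of `DMq` -/

section Locality

/-- ★★ **`DMq` IS BLOCK-LOCAL** (px16's (B1′) ✓`fderiv_chartRead_iter_apply_eq_zero_of_forall` in (PRE)'s currency): if the fine tangent `X` vanishes on every fine bond both of
whose endpoints' `(K−J)`-blocks lie in `{(bondShift B)₋, (bondShift B)₊}` — the read set of the coarse bond `B` — then `(DMq X) B = 0`.
[cite: Balaban1985Averaging, (15) p.19 (locality of the average); Balaban1987RG1, (0.4) p.253] -/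
theorem qfderiv_apply_eq_zero_of_forall {J K : ℕ} (hJK : J ≤ K) {θ : ℕ → ℝ} (hθ0 : ∀ i, 0 ≤ θ i) {α : ℝ}
    (hθα : ∀ i, J < i → i ≤ K → (((5 * F.L : ℕ) : ℝ) ^ 2 / 4) * θ i ≤ α)
    (hα24 : α ≤ 1 / 24) (hαδ : α < deltaSU (Fin 2)) (hαL : 157 * α < ((F.L : ℝ) ^ 2)⁻¹)
    {U₀ : GaugeField (F.P K) 0 (SU 2)} (hUg : U₀ ∈ histGood F ℰp θ K J)
    (X : PBond (F.P K) 0 → EuclideanSpace ℝ (Fin 3)) (B : PBond (F.P J) 0)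
    (hX : ∀ b : PBond (F.P K) 0,
      (B14.Eq22Determines.blockIter (K - J) b.src = (bondShift (F.sitesPerDir_eq (m := F.m) (K := J) (j := 0) (m' := F.m) (K' := K) (j' := K - J) (by omega)) B).src ∨
        B14.Eq22Determines.blockIter (K - J) b.src = (bondShift (F.sitesPerDir_eq (m := F.m) (K := J) (j := 0) (m' := F.m) (K' := K) (j' := K - J) (by omega)) B).tgt) →
      (B14.Eq22Determines.blockIter (K - J) b.tgt = (bondShift (F.sitesPerDir_eq (m := F.m) (K := J) (j := 0) (m' := F.m) (K' := K) (j' := K - J) (by omega)) B).src ∨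
        B14.Eq22Determines.blockIter (K - J) b.tgt = (bondShift (F.sitesPerDir_eq (m := F.m) (K := J) (j := 0) (m' := F.m) (K' := K) (j' := K - J) (by omega)) B).tgt) →
      X b = 0) :
    fderiv ℝ (fun (ζ : PBond (F.P K) 0 → EuclideanSpace ℝ (Fin 3)) (B : PBond (F.P J) 0) =>
        imVec (su2Quat (descendTo F ℰp J K hJK (fun ℓ => expPoint (ζ ℓ) * U₀ ℓ) B * (descendTo F ℰp J K hJK U₀ B)⁻¹))) 0 X B = 0 := by
  rw [qfderiv_apply_eq_iff hJK hθ0 hθα hα24 hαδ hαL hUg X B 0]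
  -- `su2Coord 0 = 0` (lit ✓`B10Eq18SigmaSU2Chart.su2Coord_zero`; re-derived inline from the linear map ✓`su2Coordₗ` to keep the import closure on the farm)
  have hzero : su2Coord (0 : Fin 3 → ℝ) = 0 := by rw [← su2Coordₗ_apply_coe, map_zero]; rfl
  have hk : K - J ≤ (F.P K).m + (F.P K).K := by show K - J ≤ F.m + K; omega
  have hz := fderiv_chartRead_iter_apply_eq_zero_of_forall (P := F.P K) (N := 2) U₀ hk
    (bondShift (F.sitesPerDir_eq (m := F.m) (K := J) (j := 0) (m' := F.m) (K' := K) (j' := K - J) (by omega)) B)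
    (fun b => (⟨su2Coord (rev (X b)), su2Coord_rev_mem_lie (X b)⟩ : (specialUnitaryLogChart (Fin 2)).lie))
    (fun b h1 h2 => by
      apply Subtype.ext
      rw [ZeroMemClass.coe_zero]
      show su2Coord (WithLp.ofLp (rev (X b))) = 0
      rw [hX b h1 h2, map_zero, WithLp.ofLp_zero]
      exact hzero)
  rw [hz]
  apply Subtype.ext
  rw [ZeroMemClass.coe_zero]
  show (0 : Matrix (Fin 2) (Fin 2) ℂ) = su2Coord (WithLp.ofLp (rev 0))
  rw [map_zero, WithLp.ofLp_zero]
  exact hzero.symm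

end Locality

end Summit.QuantumFields.YangMills.Theorems.FluctuationComparisonRegPrIntLS2BetaQuaternionReadDictionary

end
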